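import Mathlib.Topology.EMetricSpace.BoundedVariation
import Mathlib.MeasureTheory.Integral.Lebesgue.Markov
import Mathlib.MeasureTheory.Integral.Lebesgue.Add
import Mathlib.MeasureTheory.Measure.Lebesgue.Basic
import HarnessLib

/-!
# Almost every level set of a continuous function of bounded variation is finite

Topic `Literature/Analysis/FunctionSpaces`.  A weak form of Banach's indicatrix theorem
(`∫ N(f; t) dt = V(f)`, S. Banach 1925; Federer, *Geometric Measure Theory* (1969), 2.10.25 via
Eilenberg's inequality): **if `f : [a, b] → ℝ` is continuous and of bounded variation, then for
Lebesgue-almost every `t` the level set `{x ∈ [a, b] | f x = t}` is finite**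
(`ae_finite_levelSet_of_boundedVariationOn`).  This is the "area theorem" step of Schramm–Smirnov's
general-position reduction ("`α` has finite length and so for almost every `ε` the intersection
`α ∩ ∂Q^ε` is finite", *On the scaling limits of planar percolation* (2011), §2): applied to
`g ∘ γ` for a bounded-variation path `γ` and a Lipschitz level function `g`
(`LipschitzWith.comp_boundedVariationOn`).

Proof (self-contained, dyadic): with `N_n(t) = #{k < 2ⁿ : t ∈ f([x_k, x_{k+1}])}` for the dyadic
partition of `[a, b]`, `∫ N_n = Σ_k |f([x_k, x_{k+1}])| ≤ Σ_k V(f; [x_k, x_{k+1}]) = V(f; [a, b])`,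
`N_n ↑` along refinements, so `sup_n N_n < ∞` a.e. by monotone convergence; and an infinite level
set makes `N_n(t) → ∞` (distinct points are eventually separated by the partition).

## References

* H. Federer, *Geometric Measure Theory* (1969), 2.10.25 (Eilenberg's inequality; Banach's
  indicatrix). [Federer1969]
* O. Schramm, S. Smirnov, Ann. Probab. 39 (2011), §2 (the use). [SchrammSmirnov2011]
-/

noncomputable section

open Set MeasureTheory Filter
open scoped ENNReal Topology

namespace Literature.Analysis.FunctionSpaces

/-! ### Dyadic partitions of `[a, b]` -/

/-- The dyadic partition points `x_{n,k} = a + k (b - a)/2ⁿ`. [folklore] -/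
def dyadicPt (a b : ℝ) (n k : ℕ) : ℝ := a + k * ((b - a) / 2 ^ n)

/-- `x_{n,0} = a`. [folklore] -/
@[simp] theorem dyadicPt_zero (a b : ℝ) (n : ℕ) : dyadicPt a b n 0 = a := by simp [dyadicPt]

/-- `x_{n,2ⁿ} = b`. [folklore] -/
theorem dyadicPt_two_pow (a b : ℝ) (n : ℕ) : dyadicPt a b n (2 ^ n) = b := by
  simp only [dyadicPt]; push_cast; field_simp; ring

/-- Refinement: `x_{n+1,2k} = x_{n,k}`. [folklore] -/
theorem dyadicPt_succ_two_mul (a b : ℝ) (n k : ℕ) : dyadicPt a b (n + 1) (2 * k) = dyadicPt a b n k := by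
  simp only [dyadicPt]; push_cast; rw [pow_succ]; field_simp

/-- The partition points increase with `k` (`a ≤ b`). [folklore] -/
theorem dyadicPt_mono {a b : ℝ} (hab : a ≤ b) (n : ℕ) : Monotone (dyadicPt a b n) := by
  intro k l hkl
  simp only [dyadicPt]
  have h : (0 : ℝ) ≤ (b - a) / 2 ^ n := div_nonneg (by linarith) (by positivity)
  have : (k : ℝ) * ((b - a) / 2 ^ n) ≤ l * ((b - a) / 2 ^ n) :=
    mul_le_mul_of_nonneg_right (by exact_mod_cast hkl) h
  linarith

/-- Consecutive points are `(b - a)/2ⁿ` apart. [folklore] -/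
theorem dyadicPt_succ_sub (a b : ℝ) (n k : ℕ) :
    dyadicPt a b n (k + 1) - dyadicPt a b n k = (b - a) / 2 ^ n := by
  simp only [dyadicPt]; push_cast; ring

/-- The partition intervals lie in `[a, b]` for `k < 2ⁿ`. [folklore] -/
theorem dyadic_Icc_subset {a b : ℝ} (hab : a ≤ b) {n k : ℕ} (hk : k < 2 ^ n) :
    Icc (dyadicPt a b n k) (dyadicPt a b n (k + 1)) ⊆ Icc a b := by
  refine Icc_subset_Icc ?_ ?_
  · have := dyadicPt_mono hab n (Nat.zero_le k); rwa [dyadicPt_zero] at this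
  · have := dyadicPt_mono hab n (Nat.succ_le_of_lt hk); rwa [dyadicPt_two_pow] at this

/-- Refinement of intervals: `[x_{n,k}, x_{n,k+1}] = [x_{n+1,2k}, x_{n+1,2k+1}] ∪ [x_{n+1,2k+1}, x_{n+1,2k+2}]`.
[folklore] -/
theorem dyadic_Icc_eq_union {a b : ℝ} (hab : a ≤ b) (n k : ℕ) :
    Icc (dyadicPt a b n k) (dyadicPt a b n (k + 1)) =
      Icc (dyadicPt a b (n + 1) (2 * k)) (dyadicPt a b (n + 1) (2 * k + 1)) ∪
        Icc (dyadicPt a b (n + 1) (2 * k + 1)) (dyadicPt a b (n + 1) (2 * k + 1 + 1)) := by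
  have h1 : dyadicPt a b (n + 1) (2 * k) ≤ dyadicPt a b (n + 1) (2 * k + 1) :=
    dyadicPt_mono hab (n + 1) (by omega)
  have h2 : dyadicPt a b (n + 1) (2 * k + 1) ≤ dyadicPt a b (n + 1) (2 * k + 1 + 1) :=
    dyadicPt_mono hab (n + 1) (by omega)
  rw [Icc_union_Icc_eq_Icc h1 h2, show 2 * k + 1 + 1 = 2 * (k + 1) by ring, dyadicPt_succ_two_mul,
    dyadicPt_succ_two_mul]

/-! ### The dyadic indicatrix -/

/-- The dyadic indicatrix `N_n(t) = #{k < 2ⁿ : t ∈ f([x_{n,k}, x_{n,k+1}])}`, valued in `ℝ≥0∞`.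
[cite: Federer1969, 2.10.25] -/
def dyadicIndicatrix (f : ℝ → ℝ) (a b : ℝ) (n : ℕ) (t : ℝ) : ℝ≥0∞ :=
  ∑ k ∈ Finset.range (2 ^ n),
    (f '' Icc (dyadicPt a b n k) (dyadicPt a b n (k + 1))).indicator (fun _ => (1 : ℝ≥0∞)) t

/-- The image of a partition interval under a continuous function is compact, hence measurable.
[folklore] -/
theorem measurableSet_image_Icc {f : ℝ → ℝ} {a b : ℝ} (hab : a ≤ b) (hf : ContinuousOn f (Icc a b))
    {n k : ℕ} (hk : k < 2 ^ n) :
    MeasurableSet (f '' Icc (dyadicPt a b n k) (dyadicPt a b n (k + 1))) :=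
  (isCompact_Icc.image_of_continuousOn (hf.mono (dyadic_Icc_subset hab hk))).measurableSet

/-- `N_n` is measurable. [folklore] -/
theorem measurable_dyadicIndicatrix {f : ℝ → ℝ} {a b : ℝ} (hab : a ≤ b)
    (hf : ContinuousOn f (Icc a b)) (n : ℕ) : Measurable (dyadicIndicatrix f a b n) := by
  refine Finset.measurable_sum _ fun k hk => ?_
  exact measurable_const.indicator (measurableSet_image_Icc hab hf (Finset.mem_range.1 hk))

/-- **`∫ N_n ≤ V(f; [a, b])`**: the image of `[x_k, x_{k+1}]` has length at most the variation of `f`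
on it, and the variations add up along the partition. [cite: Federer1969, 2.10.25] -/
theorem lintegral_dyadicIndicatrix_le {f : ℝ → ℝ} {a b : ℝ} (hab : a ≤ b)
    (hf : ContinuousOn f (Icc a b)) (n : ℕ) :
    ∫⁻ t, dyadicIndicatrix f a b n t ≤ eVariationOn f (Icc a b) := by
  have hterm : ∀ k ∈ Finset.range (2 ^ n),
      ∫⁻ t, (f '' Icc (dyadicPt a b n k) (dyadicPt a b n (k + 1))).indicator (fun _ => (1 : ℝ≥0∞)) t ≤
        eVariationOn f (Icc (dyadicPt a b n k) (dyadicPt a b n (k + 1))) := by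
    intro k hk
    have hk' := Finset.mem_range.1 hk
    set J := Icc (dyadicPt a b n k) (dyadicPt a b n (k + 1)) with hJ
    have hJc : IsCompact J := isCompact_Icc
    have hJne : J.Nonempty := nonempty_Icc.2 (dyadicPt_mono hab n (Nat.le_succ k))
    have hfJ : ContinuousOn f J := hf.mono (dyadic_Icc_subset hab hk')
    obtain ⟨u, huJ, hu⟩ := hJc.exists_isMinOn hJne hfJ
    obtain ⟨v, hvJ, hv⟩ := hJc.exists_isMaxOn hJne hfJ
    rw [lintegral_indicator (measurableSet_image_Icc hab hf hk'), setLIntegral_const, one_mul]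
    calc volume (f '' J) ≤ volume (Icc (f u) (f v)) :=
          measure_mono (by rintro _ ⟨x, hx, rfl⟩; exact ⟨hu hx, hv hx⟩)
      _ = ENNReal.ofReal (f v - f u) := Real.volume_Icc
      _ = edist (f v) (f u) := by
          have huv : f u ≤ f v := hu hvJ
          rw [edist_dist, Real.dist_eq, abs_of_nonneg (by linarith)]
      _ ≤ eVariationOn f J := eVariationOn.edist_le f hvJ huJ
  calc ∫⁻ t, dyadicIndicatrix f a b n t
      = ∑ k ∈ Finset.range (2 ^ n), ∫⁻ t,
          (f '' Icc (dyadicPt a b n k) (dyadicPt a b n (k + 1))).indicator (fun _ => (1 : ℝ≥0∞)) t := by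
        unfold dyadicIndicatrix
        exact lintegral_finsetSum' _ fun k hk =>
          (measurable_const.indicator (measurableSet_image_Icc hab hf (Finset.mem_range.1 hk))).aemeasurable
    _ ≤ ∑ k ∈ Finset.range (2 ^ n), eVariationOn f (Icc (dyadicPt a b n k) (dyadicPt a b n (k + 1))) :=
        Finset.sum_le_sum hterm
    _ = eVariationOn f (Icc (dyadicPt a b n 0) (dyadicPt a b n (2 ^ n))) :=
        eVariationOn.sum' f (dyadicPt_mono hab n)
    _ = eVariationOn f (Icc a b) := by rw [dyadicPt_zero, dyadicPt_two_pow]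

/-- Pairing the terms of a sum over `range (2m)`. [folklore] -/
theorem sum_range_two_mul {M : Type*} [AddCommMonoid M] (h : ℕ → M) (m : ℕ) :
    ∑ j ∈ Finset.range (2 * m), h j = ∑ k ∈ Finset.range m, (h (2 * k) + h (2 * k + 1)) := by
  induction m with
  | zero => simp
  | succ m ih =>
      rw [show 2 * (m + 1) = 2 * m + 1 + 1 by ring, Finset.sum_range_succ, Finset.sum_range_succ, ih,
        Finset.sum_range_succ, add_assoc]

/-- **`N_n ≤ N_{n+1}`** (refinement: `f([x_k, x_{k+1}])` is the union of the images of the two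
halves). [folklore] -/
theorem dyadicIndicatrix_le_succ {f : ℝ → ℝ} {a b : ℝ} (hab : a ≤ b) (n : ℕ) (t : ℝ) :
    dyadicIndicatrix f a b n t ≤ dyadicIndicatrix f a b (n + 1) t := by
  unfold dyadicIndicatrix
  rw [pow_succ, mul_comm, sum_range_two_mul]
  refine Finset.sum_le_sum fun k _ => ?_
  rw [dyadic_Icc_eq_union hab n k, image_union]
  set A := f '' Icc (dyadicPt a b (n + 1) (2 * k)) (dyadicPt a b (n + 1) (2 * k + 1)) with hA
  set B := f '' Icc (dyadicPt a b (n + 1) (2 * k + 1)) (dyadicPt a b (n + 1) (2 * k + 1 + 1)) with hB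
  by_cases h1 : t ∈ A
  · rw [Set.indicator_of_mem (show t ∈ A ∪ B from Or.inl h1), Set.indicator_of_mem h1]
    exact le_self_add
  · by_cases h2 : t ∈ B
    · rw [Set.indicator_of_mem (show t ∈ A ∪ B from Or.inr h2), Set.indicator_of_mem h2]
      exact le_add_self
    · rw [Set.indicator_of_notMem (show t ∉ A ∪ B from fun h => h.elim h1 h2)]
      exact bot_le

/-- `N_n` is monotone in `n`. [folklore] -/
theorem monotone_dyadicIndicatrix {f : ℝ → ℝ} {a b : ℝ} (hab : a ≤ b) (t : ℝ) :
    Monotone fun n => dyadicIndicatrix f a b n t :=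
  monotone_nat_of_le_succ fun n => dyadicIndicatrix_le_succ hab n t

/-- Every point of `[a, b]` lies in some partition interval (`a < b`). [folklore] -/
theorem exists_mem_dyadic_Icc {a b : ℝ} (hab : a < b) (n : ℕ) {x : ℝ} (hx : x ∈ Icc a b) :
    ∃ k < 2 ^ n, x ∈ Icc (dyadicPt a b n k) (dyadicPt a b n (k + 1)) ∧
      (k = min (2 ^ n - 1) ⌊(x - a) / ((b - a) / 2 ^ n)⌋₊) := by
  set h : ℝ := (b - a) / 2 ^ n with hh
  have hpos : 0 < h := div_pos (by linarith) (by positivity)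
  set k : ℕ := min (2 ^ n - 1) ⌊(x - a) / h⌋₊ with hk
  have h2n : 1 ≤ 2 ^ n := Nat.one_le_two_pow
  refine ⟨k, by omega, ⟨?_, ?_⟩, rfl⟩
  · -- `a + k h ≤ x`
    simp only [dyadicPt]
    have h1 : (k : ℝ) ≤ (x - a) / h := by
      have : (k : ℝ) ≤ ⌊(x - a) / h⌋₊ := by exact_mod_cast min_le_right _ _
      exact this.trans (Nat.floor_le (div_nonneg (by linarith [hx.1]) hpos.le))
    have := (le_div_iff₀ hpos).1 h1
    rw [← hh]; linarith
  · -- `x ≤ a + (k+1) h`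
    simp only [dyadicPt]
    rcases le_total (2 ^ n - 1) ⌊(x - a) / h⌋₊ with hle | hle
    · have hk' : k = 2 ^ n - 1 := by rw [hk, min_eq_left hle]
      rw [hk']
      have : ((2 ^ n - 1 : ℕ) : ℝ) + 1 = (2 : ℝ) ^ n := by
        rw [Nat.cast_sub h2n]; push_cast; ring
      push_cast [Nat.cast_sub h2n] at this ⊢
      rw [← hh]
      have hb : a + (2 : ℝ) ^ n * h = b := by rw [hh]; field_simp; ring
      nlinarith [hx.2]
    · have hk' : k = ⌊(x - a) / h⌋₊ := by rw [hk, min_eq_right hle]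
      rw [hk']
      have h1 : (x - a) / h < ⌊(x - a) / h⌋₊ + 1 := Nat.lt_floor_add_one _
      have := (div_lt_iff₀ hpos).1 h1
      push_cast
      rw [← hh]; linarith

/-- **An infinite level set forces `N_n(t) → ∞`**: `M` distinct points of the level set lie in
`M` distinct partition intervals once the mesh is below their mutual distances.
[cite: Federer1969, 2.10.25] -/
theorem le_dyadicIndicatrix_of_infinite {f : ℝ → ℝ} {a b : ℝ} (hab : a < b) {t : ℝ}
    (hinf : (Icc a b ∩ f ⁻¹' {t}).Infinite) (M : ℕ) :
    ∃ n, (M : ℝ≥0∞) ≤ dyadicIndicatrix f a b n t := by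
  classical
  obtain ⟨T, hTS, hTcard⟩ := hinf.exists_subset_card_eq M
  -- a positive lower bound for the mutual distances
  obtain ⟨gap, hgap, hgaple⟩ : ∃ gap : ℝ, 0 < gap ∧ ∀ x ∈ T, ∀ y ∈ T, x ≠ y → gap ≤ dist x y := by
    by_cases hT : (T.offDiag).Nonempty
    · obtain ⟨p, hp, hmin⟩ := T.offDiag.exists_min_image (fun p => dist p.1 p.2) hT
      refine ⟨dist p.1 p.2, ?_, fun x hx y hy hxy => hmin (x, y) (Finset.mem_offDiag.2 ⟨hx, hy, hxy⟩)⟩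
      exact dist_pos.2 (Finset.mem_offDiag.1 hp).2.2
    · refine ⟨1, one_pos, fun x hx y hy hxy => (hT ⟨(x, y), Finset.mem_offDiag.2 ⟨hx, hy, hxy⟩⟩).elim⟩
  -- a mesh below the gap
  obtain ⟨n, hn⟩ : ∃ n : ℕ, (b - a) / 2 ^ n < gap := by
    obtain ⟨n, hn⟩ := exists_pow_lt_of_lt_one (div_pos hgap (by linarith : (0 : ℝ) < b - a))
      (by norm_num : (1 / 2 : ℝ) < 1)
    refine ⟨n, ?_⟩
    rw [div_lt_iff₀ (by positivity)]
    calc b - a = (b - a) * ((1 / 2) ^ n * 2 ^ n) := by rw [div_pow, one_pow, div_mul_cancel₀ _ (by positivity), mul_one]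
      _ = ((1 / 2 : ℝ) ^ n) * (b - a) * 2 ^ n := by ring
      _ < gap / (b - a) * (b - a) * 2 ^ n := by gcongr
      _ = gap * 2 ^ n := by rw [div_mul_cancel₀ _ (by linarith)]
  refine ⟨n, ?_⟩
  -- the index map
  let idx : ℝ → ℕ := fun x => min (2 ^ n - 1) ⌊(x - a) / ((b - a) / 2 ^ n)⌋₊
  have hidx : ∀ x ∈ T, idx x < 2 ^ n ∧ x ∈ Icc (dyadicPt a b n (idx x)) (dyadicPt a b n (idx x + 1)) := by
    intro x hx
    obtain ⟨k, hk, hxk, rfl⟩ := exists_mem_dyadic_Icc hab n (hTS hx).1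
    exact ⟨hk, hxk⟩
  have hinj : Set.InjOn idx ↑T := by
    intro x hx y hy hxy
    by_contra hne
    have h1 := (hidx x hx).2
    have h2 := (hidx y hy).2
    rw [hxy] at h1
    have hd : dist x y ≤ (b - a) / 2 ^ n := by
      rw [Real.dist_eq, abs_le]
      have := dyadicPt_succ_sub a b n (idx y)
      constructor <;> linarith [h1.1, h1.2, h2.1, h2.2]
    exact absurd (hgaple x hx y hy hne) (by linarith)
  -- count
  have hcount : ∑ k ∈ T.image idx, (f '' Icc (dyadicPt a b n k) (dyadicPt a b n (k + 1))).indicator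
      (fun _ => (1 : ℝ≥0∞)) t = M := by
    have h1 : ∀ k ∈ T.image idx, (f '' Icc (dyadicPt a b n k) (dyadicPt a b n (k + 1))).indicator
        (fun _ => (1 : ℝ≥0∞)) t = 1 := by
      intro k hk
      obtain ⟨x, hx, rfl⟩ := Finset.mem_image.1 hk
      exact Set.indicator_of_mem
        (show t ∈ f '' Icc (dyadicPt a b n (idx x)) (dyadicPt a b n (idx x + 1)) from
          ⟨x, (hidx x hx).2, (hTS hx).2⟩) _
    rw [Finset.sum_congr rfl h1, Finset.sum_const, Finset.card_image_of_injOn hinj, hTcard]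
    simp
  rw [← hcount]
  unfold dyadicIndicatrix
  refine Finset.sum_le_sum_of_subset_of_nonneg (fun k hk => ?_) fun _ _ _ => bot_le
  obtain ⟨x, hx, rfl⟩ := Finset.mem_image.1 hk
  exact Finset.mem_range.2 (hidx x hx).1

/-- **Almost every level set of a continuous function of bounded variation on `[a, b]` is finite**
(weak Banach indicatrix / Eilenberg inequality). [cite: Federer1969, 2.10.25] -/
theorem ae_finite_levelSet_of_boundedVariationOn {f : ℝ → ℝ} {a b : ℝ}
    (hf : ContinuousOn f (Icc a b)) (hbv : BoundedVariationOn f (Icc a b)) :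
    ∀ᵐ t ∂(volume : Measure ℝ), (Icc a b ∩ f ⁻¹' {t}).Finite := by
  rcases lt_or_ge a b with hab | hab
  · set N : ℝ → ℝ≥0∞ := fun t => ⨆ n, dyadicIndicatrix f a b n t with hN
    have hmeas : ∀ n, Measurable (dyadicIndicatrix f a b n) :=
      measurable_dyadicIndicatrix hab.le hf
    have hNmeas : Measurable N := Measurable.iSup hmeas
    have hint : ∫⁻ t, N t ≤ eVariationOn f (Icc a b) := by
      rw [hN, lintegral_iSup hmeas (fun n m hnm t => monotone_dyadicIndicatrix hab.le t hnm)]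
      exact iSup_le fun n => lintegral_dyadicIndicatrix_le hab.le hf n
    have hae : ∀ᵐ t ∂(volume : Measure ℝ), N t < ∞ :=
      ae_lt_top hNmeas (ne_top_of_le_ne_top hbv hint)
    filter_upwards [hae] with t ht
    by_contra hinf
    obtain ⟨M, hM⟩ := ENNReal.exists_nat_gt ht.ne
    obtain ⟨n, hn⟩ := le_dyadicIndicatrix_of_infinite hab hinf M
    exact absurd (hn.trans (le_iSup (fun n => dyadicIndicatrix f a b n t) n)) (not_le.2 hM)
  · refine ae_of_all _ fun t => ?_
    exact (Set.subsingleton_Icc_of_ge hab).finite.subset inter_subset_left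

/-- The same for a function of **locally** bounded variation restricted to `[a, b]`, phrased with
`eVariationOn … ≠ ∞`. [cite: Federer1969, 2.10.25] -/
theorem ae_finite_levelSet_of_eVariationOn_ne_top {f : ℝ → ℝ} {a b : ℝ}
    (hf : ContinuousOn f (Icc a b)) (hbv : eVariationOn f (Icc a b) ≠ ∞) :
    ∀ᵐ t ∂(volume : Measure ℝ), (Icc a b ∩ f ⁻¹' {t}).Finite :=
  ae_finite_levelSet_of_boundedVariationOn hf hbv

end Literature.Analysis.FunctionSpaces

end
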